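import Literature.AlgebraicGeometry.Motives.TateHypEllPowerTower
import Literature.AlgebraicGeometry.Motives.EllPowerTowerIsoOfEndomorphism
import Literature.AlgebraicGeometry.Motives.FaltingsAbelianIsogenyProofs
import Literature.AlgebraicGeometry.ComplexMultiplication.TateModuleOfCMFreeOverOrder
import Literature.AlgebraicGeometry.ComplexMultiplication.TateModuleOfCMRegularRepresentation
import Literature.NumberTheory.ComplexMultiplication.CMLatticeIdealClassPigeonhole
import Literature.NumberTheory.ComplexMultiplication.ShimuraTaniyamaOfMainTheoremAbelianScheme
import Literature.NumberTheory.GaloisRepresentations.ChebotarevRestrict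
import Literature.NumberTheory.GaloisRepresentations.CyclotomicCharacterFrobeniusProofs
import Literature.NumberTheory.DiophantineGeometry.AVCharpolySymmetry
import Literature.NumberTheory.DiophantineGeometry.AVTorsionCharpolyReductionProofs
import Mathlib.RingTheory.Discriminant
import HarnessLib

/-!
# Tate's hypothesis along `ℓ`-power towers for an abelian variety with complex multiplication

Theorems only (topic `NumberTheory/ComplexMultiplication`; no definition, no named fact).

Let `(A₀, ι₀ : 𝓞_K → End A₀)` be a structure of CM type `(K, Φ)` defined over a number field `k`
(`IsCMTypeRealisationOver Φ A₀ ι₀`, Shimura 1998 §19.7; CM by the MAXIMAL order, so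
`T_ℓ A₀` is free of rank one over `ℤ_ℓ ⊗ 𝓞_K`:
`IsCMTypeRealisationOver.exists_basis_eq_tateModuleMap_apply`, Serre–Tate 1968 §4 Remark).
**Tate's finiteness hypothesis along `ℓ`-power towers** `AbelianVariety.tateHypEllPowerTower A₀ ℓ`
(Tate 1966 §2 Hyp(k, A, ℓ); the residual citation of row VI-1 of the cell's floor, re-keyed on
[Fal83 Thm 1 + Thm 2]) **holds for `A₀` as soon as the Galois-stable lattices of `T_ℓ A₀` are
stable under an order of `𝓞_K` of bounded index** — precisely: for some `N`, every `Γ_k`-stable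
`ℤ_ℓ`-submodule `X ⊆ T_ℓ A₀` satisfies `ℓᴺ ι₀(a) X ⊆ X` for all `a ∈ 𝓞_K`
(`tateHypEllPowerTower_of_isCMTypeRealisationOver_of_stableIndex`, any CM field `K`, any
dimension).  Proof: the tower's lattices `X n = T_ℓ(f n)(T_ℓ B n)` are `Γ_k`-stable and contain
`ℓⁿ T_ℓ A₀`; the ideal-class / shape pigeonhole
(`exists_infinite_forall_exists_pow_smul_map_eq`, Shimura §7.4 Props. 15–17 made `ℓ`-adic)
relates two of them on an infinite index set by a global `ℓ`-unit `e ∈ 𝓞_K`,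
`ℓᶜ ι₀(e) X m = ℓᵃ X n`, `e e' = ℓᵈ`; and an endomorphism realising the lattice relation gives
`B m ≅ B n` (`AbelianVariety.nonempty_iso_of_ellPowerTower_of_pow_smul_map_range_eq`, Tate 1966 §2
p. 137 / Milne AV IV §2).  The index hypothesis is supplied, for CM elliptic curves, by one
Frobenius element generating `K` (Shimura–Taniyama; separate theorem).

§2–§4 (appended): the index hypothesis from ONE Frobenius element generating `K`
(`exists_stableIndex_of_tateRep_eq_tateModuleMap`: `disc(ℤ[π]) · 𝓞_K ⊆ ℤ[π]`, Mathlib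
`Algebra.discr_mul_isIntegral_mem_adjoin`); such an element for CM ELLIPTIC structures
(`[K : ℚ] = 2`) from Shimura–Taniyama at a degree-one place and the Weil pairing
(`exists_tateRep_eq_tateModuleMap_and_adjoin_eq_top`, granted `shimura1998_thm18_6`); and the
§6.4 head of the cell's T5 line, `tateHypEllPowerTower_of_CM_elliptic_of_thm18_6`: **Tate's
hypothesis along `ℓ`-power towers holds for every CM elliptic structure `(A₀, ι₀)` over a number
field**, granted [Shimura 1998, Thm. 18.6] (discharged Summits-side).

## References

* [Tate1966Endomorphisms] J. Tate, Invent. Math. 2 (1966), §2, pp. 136–137.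
* [Shimura1998] G. Shimura, *Abelian Varieties with Complex Multiplication and Modular Functions*
  (1998), §7.4 Props. 15, 17; §19.7.
* [SerreTate1968] J.-P. Serre, J. Tate, Ann. of Math. 88 (1968), §4 Thm. 5 and Remark.
-/

noncomputable section

open CategoryTheory Polynomial
open scoped NumberField Pointwise IntermediateField

namespace Literature.NumberTheory.ComplexMultiplication

open Literature.AlgebraicGeometry.Motives Literature.AlgebraicGeometry.Motives.AbelianVariety

/-- **Tate's hypothesis along `ℓ`-power towers for a CM abelian variety whose Galois-stable
lattices are stable under an order of bounded index** (Tate 1966 §2 for the lattices; Shimura 1998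
§7.4 Props. 15–17 for the ideal classes): if `(A₀, ι₀)` is of CM type `(K, Φ)` over `k` and, for
some `N`, `ℓᴺ T_ℓ(ι₀ a) X ⊆ X` for every `Γ_k`-stable `ℤ_ℓ`-submodule `X ⊆ T_ℓ A₀` and every
`a ∈ 𝓞_K`, then along every `ℓ`-power tower onto `A₀` infinitely many members are mutually
isomorphic over `k`. [cite: Tate1966Endomorphisms, §2 pp. 136–137]
[cite: Shimura1998, §7.4 Propositions 15 and 17] -/
theorem tateHypEllPowerTower_of_isCMTypeRealisationOver_of_stableIndex
    {k : Type} [Field k] [Algebra k ℂ] {K : Type} [Field K] [NumberField K]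
    [NumberField.IsCMField K] (Φ : CMType K) (A₀ : AbelianVariety k) (ι₀ : 𝓞 K →+* End A₀)
    (hA : IsCMTypeRealisationOver Φ A₀ ι₀) (ℓ : ℕ) [Fact ℓ.Prime] (N : ℕ)
    (hgal : ∀ X : Submodule ℤ_[ℓ] (A₀.tateModule ℓ),
      (∀ (σ : Field.absoluteGaloisGroup k) (x : A₀.tateModule ℓ), x ∈ X → A₀.tateRep ℓ σ x ∈ X) →
      ∀ (a : 𝓞 K) (x : A₀.tateModule ℓ), x ∈ X →
        (ℓ : ℤ_[ℓ]) ^ N • tateModuleMap ℓ (ι₀ a : A₀ ⟶ A₀) x ∈ X) :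
    A₀.tateHypEllPowerTower ℓ := by
  intro _ B f h hf hh hhf hfh
  classical
  -- `T_ℓ A₀` is free of rank one over `ℤ_ℓ ⊗ 𝓞_K`
  obtain ⟨t₀, Bas, hBas⟩ := hA.exists_basis_eq_tateModuleMap_apply ℓ
  -- the action `ι = T_ℓ ∘ ι₀` as a ring homomorphism
  let ι : 𝓞 K →+* Module.End ℤ_[ℓ] (A₀.tateModule ℓ) :=
    { toFun := fun a => tateModuleMap ℓ (ι₀ a : A₀ ⟶ A₀)
      map_one' := by simp only [map_one]; exact tateModuleMap_id ℓ A₀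
      map_mul' := fun a b => by
        simp only [map_mul]
        change tateModuleMap ℓ ((ι₀ b : A₀ ⟶ A₀) ≫ (ι₀ a : A₀ ⟶ A₀)) = _
        rw [tateModuleMap_comp]; rfl
      map_zero' := by simp only [map_zero]; exact tateModuleMap_zero ℓ
      map_add' := fun a b => by simp only [map_add]; exact tateModuleMap_add ℓ _ _ }
  have hι : ∀ a, ι a = tateModuleMap ℓ (ι₀ a : A₀ ⟶ A₀) := fun a => rfl
  have hBas' : ∀ j, Bas j = ι (NumberField.RingOfIntegers.basis K j) t₀ := fun j => by
    rw [hι]; exact hBas j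
  -- the lattices of the tower
  set X : ℕ → Submodule ℤ_[ℓ] (A₀.tateModule ℓ) := fun n => LinearMap.range (tateModuleMap ℓ (f n))
    with hX
  have htop : ∀ i, ∃ j : ℕ, (ℓ : ℤ_[ℓ]) ^ j • (⊤ : Submodule ℤ_[ℓ] (A₀.tateModule ℓ)) ≤ X i :=
    fun i => ⟨i, by
      rw [hX]
      simp only
      rw [← range_tateModuleMap_pow_smul_id ℓ A₀ i, ← hhf i, tateModuleMap_comp]
      exact LinearMap.range_comp_le_range _ _⟩
  have hst : ∀ (i : ℕ) (a : 𝓞 K) (x : A₀.tateModule ℓ), x ∈ X i →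
      (ℓ : ℤ_[ℓ]) ^ N • ι a x ∈ X i := fun i a x hx =>
    hgal (X i) (fun σ y hy => by
      obtain ⟨z, rfl⟩ := hy
      exact ⟨(B i).tateRep ℓ σ z, tateModuleMap_smul (f i) σ z⟩) a x hx
  -- the ideal-class / shape pigeonhole
  obtain ⟨S, hSinf, hS⟩ := exists_infinite_forall_exists_pow_smul_map_eq ι t₀
    (NumberField.RingOfIntegers.basis K) Bas hBas' N X htop hst
  refine ⟨S, hSinf, fun m hm n hn => ?_⟩
  obtain ⟨e, e', a, c, d, hee', hrel⟩ := hS m hm n hn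
  -- `ι₀ e` is an isogeny, invertible up to `ℓᵈ`
  have hcomp : ∀ x y : 𝓞 K, x * y = (ℓ : 𝓞 K) ^ d →
      (ι₀ x : A₀ ⟶ A₀) ≫ (ι₀ y : A₀ ⟶ A₀) = (ℓ ^ d) • 𝟙 A₀ := fun x y hxy => by
    change ι₀ y * ι₀ x = _
    rw [← map_mul, mul_comm, hxy, map_pow, map_natCast, ← Nat.cast_pow, ← nsmul_one]
    rfl
  have he : (ι₀ e : A₀ ⟶ A₀) ≫ (ι₀ e' : A₀ ⟶ A₀) = (ℓ ^ d) • 𝟙 A₀ := hcomp e e' hee'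
  have he' : (ι₀ e' : A₀ ⟶ A₀) ≫ (ι₀ e : A₀ ⟶ A₀) = (ℓ ^ d) • 𝟙 A₀ :=
    hcomp e' e (by rw [mul_comm, hee'])
  have hcast : ((ℓ ^ d : ℕ) : k) ≠ 0 :=
    Nat.cast_ne_zero.mpr (pow_ne_zero d (Fact.out : ℓ.Prime).ne_zero)
  have hℓd : IsIsogeny ((ℓ ^ d) • 𝟙 A₀) := isIsogeny_nsmul_id_of_cast_ne_zero A₀ (ℓ ^ d) hcast
  have heI : IsIsogeny (ι₀ e : A₀ ⟶ A₀) :=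
    isIsogeny_of_isIsogeny_comp_of_isIsogeny_comp (he ▸ hℓd) (he' ▸ hℓd)
  exact nonempty_iso_of_ellPowerTower_of_pow_smul_map_range_eq ℓ A₀ B f h hf hh hhf hfh
    (ι₀ e : A₀ ⟶ A₀) (ι₀ e' : A₀ ⟶ A₀) a d c heI he hrel

/-! ## §2 A Frobenius element generating `K` bounds the index of the stabiliser order -/

/-- **An integer multiple of `𝓞_K` lies in `ℤ[π]` when `ℚ(π) = K`**: for `π ∈ 𝓞_K` with `ℚ⟮π⟯ = K`
there is a non-zero integer `z` (the discriminant of the power basis `1, π, …, π^{n-1}`) with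
`z · a ∈ ℤ[π]` for every `a ∈ 𝓞_K` (Mathlib `Algebra.discr_mul_isIntegral_mem_adjoin`).
[cite: Shimura1998, §7.4 Proposition 15] -/
theorem exists_int_mul_mem_adjoin_of_adjoin_eq_top {K : Type*} [Field K] [NumberField K]
    (π : 𝓞 K) (hπ : ℚ⟮(π : K)⟯ = ⊤) :
    ∃ z : ℤ, z ≠ 0 ∧ ∀ a : 𝓞 K, ∃ p : ℤ[X], ((z : 𝓞 K) * a) = aeval π p := by
  have hπK : IsIntegral ℤ (π : K) := NumberField.RingOfIntegers.isIntegral_coe π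
  have hπQ : IsIntegral ℚ (π : K) := hπK.tower_top
  -- the power basis of `K = ℚ(π)` generated by `π`
  let e : ℚ⟮(π : K)⟯ ≃ₐ[ℚ] K := (IntermediateField.equivOfEq hπ).trans IntermediateField.topEquiv
  let pb : PowerBasis ℚ K := (IntermediateField.adjoin.powerBasis hπQ).map e
  have hgen : pb.gen = (π : K) := by
    change e (IntermediateField.adjoin.powerBasis hπQ).gen = _
    rw [IntermediateField.adjoin.powerBasis_gen]
    rfl
  have hint : IsIntegral ℤ pb.gen := hgen ▸ hπK
  -- its discriminant: a non-zero rational integer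
  have hd0 : Algebra.discr ℚ pb.basis ≠ 0 := Algebra.discr_not_zero_of_basis ℚ pb.basis
  have hdint : IsIntegral ℤ (Algebra.discr ℚ pb.basis) :=
    Algebra.discr_isIntegral (K := ℚ) fun i => by
      rw [pb.basis_eq_pow, hgen]; exact hπK.pow i
  obtain ⟨z, hz⟩ := (IsIntegrallyClosed.isIntegral_iff (R := ℤ) (K := ℚ)).mp hdint
  refine ⟨z, fun h0 => hd0 (by rw [← hz, h0, map_zero]), fun a => ?_⟩
  have hmem := Algebra.discr_mul_isIntegral_mem_adjoin (R := ℤ) (K := ℚ) (L := K) (B := pb) hint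
    (NumberField.RingOfIntegers.isIntegral_coe a)
  rw [hgen, Algebra.adjoin_singleton_eq_range_aeval] at hmem
  obtain ⟨p, hp⟩ := hmem
  refine ⟨p, ?_⟩
  apply NumberField.RingOfIntegers.coe_injective
  have hp' : aeval (π : K) p = Algebra.discr ℚ pb.basis • ((a : 𝓞 K) : K) := hp
  have h1 : algebraMap (𝓞 K) K (aeval π p) = Algebra.discr ℚ pb.basis • ((a : 𝓞 K) : K) := by
    rw [← hp']
    exact (aeval_algHom_apply (IsScalarTower.toAlgHom ℤ (𝓞 K) K) π p).symm
  change algebraMap (𝓞 K) K ((z : 𝓞 K) * a) = algebraMap (𝓞 K) K (aeval π p)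
  rw [h1, ← hz, map_mul, Algebra.smul_def, map_intCast, eq_intCast, map_intCast]

/-- **A Frobenius element generating `K` bounds the stabiliser order of every Galois-stable
lattice** (Tate 1966 §2 p. 136: the lattices `X ⊆ T_ℓ A` are stable under the order `R` generated by
the image of Galois): if some `σ₀ ∈ Γ_k` acts on `T_ℓ A₀` as `T_ℓ(ι₀ π)` with `ℚ(π) = K`, then for
`z = disc(ℤ[π])` and `ℓᴺ ∥ z`, every `Γ_k`-stable `ℤ_ℓ`-submodule `X ⊆ T_ℓ A₀` satisfies
`ℓᴺ T_ℓ(ι₀ a) X ⊆ X` for all `a ∈ 𝓞_K` (`z a ∈ ℤ[π]` acts through `ℤ_ℓ[ρ(σ₀)]`).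
[cite: Tate1966Endomorphisms, §2 p. 136] -/
theorem exists_stableIndex_of_tateRep_eq_tateModuleMap {k : Type} [Field k] {K : Type*} [Field K]
    [NumberField K] (A₀ : AbelianVariety k) (ι₀ : 𝓞 K →+* End A₀) (ℓ : ℕ) [Fact ℓ.Prime]
    (σ₀ : Field.absoluteGaloisGroup k) (π : 𝓞 K)
    (hσ₀ : A₀.tateRep ℓ σ₀ = tateModuleMap ℓ (ι₀ π : A₀ ⟶ A₀)) (hπ : ℚ⟮(π : K)⟯ = ⊤) :
    ∃ N : ℕ, ∀ X : Submodule ℤ_[ℓ] (A₀.tateModule ℓ),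
      (∀ (σ : Field.absoluteGaloisGroup k) (x : A₀.tateModule ℓ), x ∈ X → A₀.tateRep ℓ σ x ∈ X) →
      ∀ (a : 𝓞 K) (x : A₀.tateModule ℓ), x ∈ X →
        (ℓ : ℤ_[ℓ]) ^ N • tateModuleMap ℓ (ι₀ a : A₀ ⟶ A₀) x ∈ X := by
  classical
  obtain ⟨z, hz0, hz⟩ := exists_int_mul_mem_adjoin_of_adjoin_eq_top π hπ
  -- `T_ℓ ∘ ι₀` as a ring homomorphism
  let ι : 𝓞 K →+* Module.End ℤ_[ℓ] (A₀.tateModule ℓ) :=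
    { toFun := fun a => tateModuleMap ℓ (ι₀ a : A₀ ⟶ A₀)
      map_one' := by simp only [map_one]; exact tateModuleMap_id ℓ A₀
      map_mul' := fun a b => by
        simp only [map_mul]
        change tateModuleMap ℓ ((ι₀ b : A₀ ⟶ A₀) ≫ (ι₀ a : A₀ ⟶ A₀)) = _
        rw [tateModuleMap_comp]; rfl
      map_zero' := by simp only [map_zero]; exact tateModuleMap_zero ℓ
      map_add' := fun a b => by simp only [map_add]; exact tateModuleMap_add ℓ _ _ }
  have hι : ∀ a, ι a = tateModuleMap ℓ (ι₀ a : A₀ ⟶ A₀) := fun a => rfl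
  -- `z = u ℓᴺ` in `ℤ_ℓ`
  have hzℓ : ((z : ℤ_[ℓ])) ≠ 0 := Int.cast_ne_zero.mpr hz0
  set N : ℕ := ((z : ℤ_[ℓ])).valuation with hN
  refine ⟨N, fun X hX a x hx => ?_⟩
  -- powers and polynomials of `ρ(σ₀)` preserve `X`
  have hpow : ∀ (n : ℕ) (y : A₀.tateModule ℓ), y ∈ X → ((A₀.tateRep ℓ σ₀) ^ n) y ∈ X := by
    intro n
    induction n with
    | zero => intro y hy; rwa [pow_zero, Module.End.one_apply]
    | succ n ih => intro y hy; rw [pow_succ, Module.End.mul_apply]; exact ih _ (hX σ₀ y hy)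
  have hpol : ∀ (q : ℤ[X]) (y : A₀.tateModule ℓ), y ∈ X → aeval (A₀.tateRep ℓ σ₀) q y ∈ X := by
    intro q
    induction q using Polynomial.induction_on' with
    | add q₁ q₂ h₁ h₂ =>
      intro y hy
      rw [map_add, LinearMap.add_apply]
      exact X.add_mem (h₁ y hy) (h₂ y hy)
    | monomial n c =>
      intro y hy
      rw [aeval_monomial, Module.End.mul_apply, eq_intCast, Module.End.intCast_apply,
        ← Int.cast_smul_eq_zsmul ℤ_[ℓ]]
      exact X.smul_mem _ (hpow n y hy)
  -- `z · T_ℓ(ι₀ a) x ∈ X`: `z a = p(π)` and `p(ρ(σ₀))` preserves `X`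
  obtain ⟨p, hp⟩ := hz a
  have hza : ((z : ℤ_[ℓ])) • tateModuleMap ℓ (ι₀ a : A₀ ⟶ A₀) x ∈ X := by
    have h1 : ((z : ℤ_[ℓ])) • tateModuleMap ℓ (ι₀ a : A₀ ⟶ A₀) x = ι ((z : 𝓞 K) * a) x := by
      rw [map_mul, map_intCast, Module.End.mul_apply, hι, Module.End.intCast_apply,
        Int.cast_smul_eq_zsmul]
    rw [h1, hp]
    change (ι.toIntAlgHom (aeval π p)) x ∈ X
    rw [← aeval_algHom_apply]
    have h2 : ι.toIntAlgHom π = A₀.tateRep ℓ σ₀ := by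
      rw [RingHom.toIntAlgHom_apply, hι, hσ₀]
    rw [h2]
    exact hpol p x hx
  -- `ℓᴺ = u⁻¹ z` in `ℤ_ℓ`
  have hzu := PadicInt.unitCoeff_spec hzℓ
  have hunit : ((PadicInt.unitCoeff hzℓ)⁻¹ : ℤ_[ℓ]ˣ).val * (z : ℤ_[ℓ]) = (ℓ : ℤ_[ℓ]) ^ N := by
    have : ((PadicInt.unitCoeff hzℓ)⁻¹ : ℤ_[ℓ]ˣ).val *
        ((PadicInt.unitCoeff hzℓ : ℤ_[ℓ]) * (ℓ : ℤ_[ℓ]) ^ ((z : ℤ_[ℓ])).valuation) =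
        (ℓ : ℤ_[ℓ]) ^ N := by
      rw [← mul_assoc, Units.inv_mul, one_mul, hN]
    rwa [← hzu] at this
  have key : (ℓ : ℤ_[ℓ]) ^ N • tateModuleMap ℓ (ι₀ a : A₀ ⟶ A₀) x =
      ((PadicInt.unitCoeff hzℓ)⁻¹ : ℤ_[ℓ]ˣ).val • (((z : ℤ_[ℓ])) • tateModuleMap ℓ (ι₀ a : A₀ ⟶ A₀) x) := by
    rw [smul_smul, hunit]
  rw [key]
  exact X.smul_mem _ hza

/-! ## §3 A Frobenius element generating the CM field (CM elliptic structures) -/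

/-- **For a CM elliptic structure `(A₀, ι₀)` of type `(K, Φ)` over `k` (`[K : ℚ] = 2`), some
`σ₀ ∈ Γ_k` acts on `T_ℓ A₀` as `T_ℓ(ι₀ π)` with `ℚ(π) = K`** — granted Shimura's Thm. 18.6
(`shimura1998_thm18_6`): by the Shimura–Taniyama description of Frobenius
(`shimuraTaniyamaHecke…ST_eventually_of_thm18_6`, clause (5ST)) at a place `v ∤ ℓ` of residue
degree one (Chebotarev: `infinite_setOf_prime_absNorm_frobenius_restrict_eq`), the arithmetic
Frobenius `σ₀` at `𝔓 ∣ v` acts as `T_ℓ(ι₀ π_v)`; and `N_{K/ℚ}(π_v) = det ρ_ℓ(σ₀) = N v = p` is a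
prime (Weil pairing: `coeff_zero_charpoly_rationalTateRep`, `cyclotomicCharacter_apply_of_isArithFrobAt`;
Shimura §5.1 Prop. 2: `charpoly_tateModuleMap_map_eq_of_ringOfIntegers`), so `π_v ∉ ℚ` and
`ℚ(π_v) = K`. [cite: Shimura1998, §13.1 Theorem 1 (ii) and §18.6 Theorem 18.6]
[cite: SerreTate1968, §7 Theorems 10–11] -/
theorem exists_tateRep_eq_tateModuleMap_and_adjoin_eq_top (h186 : shimura1998_thm18_6)
    {k : Type} [Field k] [NumberField k] [Algebra k ℂ] {K : Type} [Field K] [NumberField K]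
    [NumberField.IsCMField K] (Φ : CMType K) (A₀ : AbelianVariety k) (ι₀ : 𝓞 K →+* End A₀)
    (hA : IsCMTypeRealisationOver Φ A₀ ι₀) (h2 : Module.finrank ℚ K = 2) (ℓ : ℕ) [Fact ℓ.Prime] :
    ∃ (σ₀ : Field.absoluteGaloisGroup k) (π : 𝓞 K),
      A₀.tateRep ℓ σ₀ = tateModuleMap ℓ (ι₀ π : A₀ ⟶ A₀) ∧ ℚ⟮(π : K)⟯ = ⊤ := by
  classical
  have hℓk : (ℓ : k) ≠ 0 := Nat.cast_ne_zero.mpr (Fact.out : ℓ.Prime).ne_zero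
  have hℓ0 : (ℓ : 𝓞 k) ≠ 0 := Nat.cast_ne_zero.mpr (Fact.out : ℓ.Prime).ne_zero
  -- (5ST) at cofinitely many places
  obtain ⟨χ, -, -, -, hev⟩ :=
    shimuraTaniyama_heckeCharactersST_eventually_of_thm18_6 h186 k K Φ A₀ ι₀ hA
  rw [Filter.eventually_cofinite] at hev
  -- the primes above `ℓ` are finitely many
  have hℓfin : {v : IsDedekindDomain.HeightOneSpectrum (𝓞 k) | (ℓ : 𝓞 k) ∈ v.asIdeal}.Finite := by
    refine (Ideal.finite_factors (I := Ideal.span {(ℓ : 𝓞 k)}) ?_).subset fun v hv => ?_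
    · rw [Ideal.zero_eq_bot, Ne, Ideal.span_singleton_eq_bot]; exact hℓ0
    · exact (Ideal.dvd_span_singleton).mpr hv
  -- Chebotarev: infinitely many degree-one places with an arithmetic Frobenius
  have hinf := Literature.NumberTheory.GaloisRepresentations.infinite_setOf_prime_absNorm_frobenius_restrict_eq
    (F := k) ⊥ 1
  obtain ⟨v, ⟨hvprime, -, 𝔓, h𝔓, σ, hσ, -⟩, hvnot⟩ := (hinf.sdiff (hev.union hℓfin)).nonempty
  simp only [Set.mem_union, Set.mem_setOf_eq, not_or, not_not] at hvnot
  obtain ⟨⟨π, -, hfrob, -⟩, hvℓ⟩ := hvnot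
  have hσ₀ : A₀.tateRep ℓ σ = tateModuleMap ℓ (ι₀ π : A₀ ⟶ A₀) := hfrob ℓ hvℓ 𝔓 h𝔓 σ hσ
  refine ⟨σ, π, hσ₀, ?_⟩
  -- `N_{K/ℚ}(π) = N v`
  haveI := module_free_tateModule_holds A₀ ℓ hℓk
  haveI := module_finite_tateModule_of_cast_ne_zero A₀ ℓ hℓk
  haveI := module_finite_rationalTateModule_of_cast_ne_zero A₀ ℓ hℓk
  have hdim : A₀.dim = 1 := by have := hA.finrank_eq; omega
  have hc0 : (A₀.rationalTateRep ℓ σ).charpoly.coeff 0 = (v.residueCard : ℚ_[ℓ]) := by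
    rw [A₀.coeff_zero_charpoly_rationalTateRep ℓ hℓk σ,
      Literature.NumberTheory.GaloisRepresentations.GaloisRep.cyclotomicCharacter_apply_of_isArithFrobAt
        hvℓ h𝔓 hσ, hdim, pow_one, PadicInt.coe_natCast]
  have hchar : (A₀.rationalTateRep ℓ σ).charpoly =
      (Algebra.lmul ℚ K (π : K)).charpoly.map (algebraMap ℚ ℚ_[ℓ]) := by
    rw [A₀.charpoly_rationalTateRep_eq_map ℓ σ, hσ₀]
    exact Literature.AlgebraicGeometry.ComplexMultiplication.charpoly_tateModuleMap_map_eq_of_ringOfIntegers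
      hℓk ι₀ hA.finrank_eq π
  have hnorm0 : (Algebra.lmul ℚ K (π : K)).charpoly.coeff 0 = Algebra.norm ℚ (π : K) := by
    rw [Algebra.norm_apply, LinearMap.det_eq_sign_charpoly_coeff, h2]
    norm_num
  have hnorm : (Algebra.norm ℚ (π : K) : ℚ) = (v.residueCard : ℚ) := by
    apply (algebraMap ℚ ℚ_[ℓ]).injective
    rw [← hnorm0, ← Polynomial.coeff_map, ← hchar, hc0, map_natCast]
  -- `π ∉ ℚ`: `N v` is a prime, not a rational square
  have hπQ : IsIntegral ℚ (π : K) := (NumberField.RingOfIntegers.isIntegral_coe π).tower_top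
  have hnotmem : (π : K) ∉ (algebraMap ℚ K).range := by
    rintro ⟨r, hr⟩
    have hsq : r ^ 2 = (v.residueCard : ℚ) := by
      rw [← hnorm, ← hr, Algebra.norm_algebraMap, h2]
    have hp : (v.residueCard).Prime := hvprime
    have hr0 : r ≠ 0 := by
      rintro rfl
      rw [zero_pow two_ne_zero] at hsq
      exact hp.ne_zero (by exact_mod_cast hsq.symm)
    haveI : Fact (v.residueCard).Prime := ⟨hp⟩
    have hval := congrArg (padicValRat v.residueCard) hsq
    rw [padicValRat.pow, padicValRat.self hp.one_lt] at hval
    omega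
  -- hence `ℚ(π) = K`
  have h2le : 2 ≤ Module.finrank ℚ ℚ⟮(π : K)⟯ := by
    rw [IntermediateField.adjoin.finrank hπQ]
    exact (minpoly.two_le_natDegree_iff hπQ).mpr hnotmem
  have htower := Module.finrank_mul_finrank ℚ ℚ⟮(π : K)⟯ K
  have hpos : 0 < Module.finrank ℚ⟮(π : K)⟯ K := Module.finrank_pos
  have hfin : Module.finrank ℚ ℚ⟮(π : K)⟯ = Module.finrank ℚ K := by
    rw [h2] at htower ⊢
    nlinarith
  exact IntermediateField.eq_of_le_of_finrank_eq le_top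
    (hfin.trans (IntermediateField.finrank_top' (F := ℚ) (E := K)).symm)


/-! ## §4 The §6.4 head: Tate's hypothesis along `ℓ`-power towers for CM elliptic structures -/

/-- **Tate's finiteness hypothesis along `ℓ`-power towers holds for every CM elliptic structure
over a number field, granted [Shimura 1998, Thm. 18.6]** (T5 §6.4 first rung of the cell
hodgecm-mathlib; text = the `faltings_isogeny` v4 slot `stub_tateHypEllPowerTower_of_CM_elliptic`
behind `h186`): for `(A₀, ι₀ : 𝓞_K → End A₀)` of CM type `(K, Φ)` over `k` with `[K : ℚ] = 2` and
every prime `ℓ`, along every `ℓ`-power isogeny tower onto `A₀` infinitely many members are mutually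
`k`-isomorphic.  Assembly of `exists_tateRep_eq_tateModuleMap_and_adjoin_eq_top` (Shimura–Taniyama at
a degree-one place), `exists_stableIndex_of_tateRep_eq_tateModuleMap` (bounded index) and
`tateHypEllPowerTower_of_isCMTypeRealisationOver_of_stableIndex` (ideal-class / shape pigeonhole and
the realising endomorphism).  [cite: Tate1966Endomorphisms, §2 pp. 136–137]
[cite: Shimura1998, §7.4 Propositions 15 and 17; §18.6 Theorem 18.6] -/
theorem tateHypEllPowerTower_of_CM_elliptic_of_thm18_6 (h186 : shimura1998_thm18_6) :
    ∀ {k : Type} [Field k] [Algebra k ℂ] {K : Type} [Field K] [NumberField K]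
      [NumberField.IsCMField K] (Φ : CMType K) (A₀ : AbelianVariety k) (ι₀ : 𝓞 K →+* End A₀),
      IsCMTypeRealisationOver Φ A₀ ι₀ → Module.finrank ℚ K = 2 →
      ∀ (ℓ : ℕ) [Fact ℓ.Prime], A₀.tateHypEllPowerTower ℓ := by
  intro k _ _ K _ _ _ Φ A₀ ι₀ hA h2 ℓ _ _ B f h hf hh hhf hfh
  obtain ⟨σ₀, π, hσ₀, hπ⟩ := exists_tateRep_eq_tateModuleMap_and_adjoin_eq_top h186 Φ A₀ ι₀ hA h2 ℓ
  obtain ⟨N, hgal⟩ := exists_stableIndex_of_tateRep_eq_tateModuleMap A₀ ι₀ ℓ σ₀ π hσ₀ hπ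
  exact tateHypEllPowerTower_of_isCMTypeRealisationOver_of_stableIndex Φ A₀ ι₀ hA ℓ N hgal B f h hf hh
    hhf hfh

end Literature.NumberTheory.ComplexMultiplication

end
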